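/-
Copyright (c) 2026. All rights reserved.
Released under Apache 2.0 license as described in the file LICENSE.
Authors: abc-iut cell, campaign-S prover seat abc-iut-S7.
-/
import Literature.IUT.LogVolume.TensorPacketHaar
import Literature.IUT.LogVolume.TensorPacketVolume
import Literature.IUT.LogVolume.TensorPacketMeasure
import Literature.IUT.LogVolume.FundamentalIdentity
import Literature.IUT.LogVolume.HaarTransport
import HarnessLib

/-!
# Bridge: the decomposition log-volume `packetLogVolume ψ` equals the intrinsic `tensorLogVolume`

Two renderings of the log-volume "`μ^log`" on a tensor packet `V = ⊗_{ℚ_p} k_i` of [IUTchIV] Prop. 1.4 (i)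
(kurims p. 13: "by applying the fact that tensor products of finitely many finite extensions of `ℚ_p`
over `ℤ_p` decompose … we obtain a notion of log-volume … normalized so that `μ^log((R_E)^∼) = 0`,
`μ^log(p·(R_E)^∼) = −log(p)`") coexist in this directory:

* `packetLogVolume p k L ψ` (`TensorPacketVolume.lean`, abc-iut-S8): through a decomposition datum
  `ψ : V ≃ₐ[ℚ_p] ∏_j L_j`, the product Haar measure on `⊕_j L_j` normalised at `∏ O_{L_j}`, divided by
  `D = Σ_j e_j f_j`;
* `tensorLogVolume p k` (`TensorPacketHaar.lean`): the Haar measure of `V` itself (module topology)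
  normalised at `(R_I)^∼` and divided by `dim_{ℚ_p} V`.

**They agree** (`packetLogVolume_eq_tensorLogVolume`) on every set of positive finite volume: `ψ` is a
bicontinuous additive isomorphism carrying `(R_I)^∼` onto `∏ O_{L_j}` (S8's `image_normalizedPacket`), so
Haar uniqueness transports one normalised measure to the other (`HaarTransport.logVolume_image_equiv`),
and `D = Σ_j [L_j : ℚ_p] = dim V` by the fundamental identity `e·f = [L:ℚ_p]` (`FundamentalIdentity.lean`).
Consequences: `packetLogVolume` does not depend on `ψ` (`packetLogVolume_eq_of_decompositions`), and a
decomposition forces `(R_I)^∼` to be compact (`isCompact_normalizedPacket_of_decomposition`), which makes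
the normalising constant of `tensorLogVolume` honest.  Classical; nothing disputed.
[cite: Mochizuki2012, IUTchIV Prop. 1.4 (i) p. 13]
-/

noncomputable section

open MeasureTheory Set Metric TopologicalSpace Module
open scoped NNReal ENNReal Pointwise TensorProduct NormedField

namespace Literature.IUT.LogVolume

variable (p : ℕ) [Fact p.Prime]
variable {I : Type} [Fintype I] [DecidableEq I]
variable (k : I → Type) [∀ i, NontriviallyNormedField (k i)] [∀ i, NormedAlgebra ℚ_[p] (k i)]
  [∀ i, IsUltrametricDist (k i)] [∀ i, ProperSpace (k i)] [Nonempty I]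
variable {J : Type} [Fintype J] (L : J → Type) [∀ j, NontriviallyNormedField (L j)]
  [∀ j, NormedAlgebra ℚ_[p] (L j)] [∀ j, IsUltrametricDist (L j)] [∀ j, ProperSpace (L j)]
/-- `⊕_j L_j` carries the module topology (each `L_j` is a finite-dimensional normed `ℚ_p`-space).
[cite: Mochizuki2012, IUTchIV Prop. 1.4 (i) p. 13] -/
theorem isModuleTopology_pi : IsModuleTopology ℚ_[p] (Π j, L j) := by
  haveI : ∀ j, FiniteDimensional ℚ_[p] (L j) := fun j => finiteDimensional p (L j)
  haveI : ∀ j, IsModuleTopology ℚ_[p] (L j) := fun j => isModuleTopologyOfFiniteDimensional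
  infer_instance

variable (ψ : PacketAlgebra p k ≃ₐ[ℚ_[p]] (Π j, L j))

include ψ

/-- **A decomposition `ψ : V ≃ₐ ∏ L_j` is a homeomorphism** (as an additive isomorphism): both sides
carry the module topology, for which linear maps are continuous. [cite: Mochizuki2012, IUTchIV Prop. 1.4 (i) p. 13] -/
def decompositionEquiv : PacketAlgebra p k ≃ₜ+ (Π j, L j) :=
  haveI := isModuleTopology_pi p L
  haveI : ContinuousAdd (PacketAlgebra p k) := IsModuleTopology.toContinuousAdd ℚ_[p] _
  { ψ.toLinearEquiv.toAddEquiv with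
    continuous_toFun := IsModuleTopology.continuous_of_linearMap ψ.toLinearEquiv.toLinearMap
    continuous_invFun := IsModuleTopology.continuous_of_linearMap ψ.toLinearEquiv.symm.toLinearMap }

omit [Fintype I] [DecidableEq I] [∀ i, IsUltrametricDist (k i)] [∀ i, ProperSpace (k i)] [Nonempty I] in
/-- Unfolding `decompositionEquiv`. [cite: Mochizuki2012, IUTchIV Prop. 1.4 (i) p. 13] -/
@[simp] theorem decompositionEquiv_apply (x : PacketAlgebra p k) : decompositionEquiv p k L ψ x = ψ x := rfl

/-- **A decomposition forces `(R_I)^∼` to be compact**: it is the preimage of the compact unit polydisc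
`∏ O_{L_j}` under the homeomorphism `ψ`. [cite: Mochizuki2012, IUTchIV Prop. 1.1 p. 9] -/
theorem isCompact_normalizedPacket_of_decomposition :
    IsCompact (normalizedPacket p k : Set (PacketAlgebra p k)) := by
  have h := image_normalizedPacket p k L ψ
  have : (normalizedPacket p k : Set (PacketAlgebra p k)) =
      decompositionEquiv p k L ψ ⁻¹' polydisc L (fun _ => 1) := by
    rw [← h]
    exact (Set.preimage_image_eq _ (decompositionEquiv p k L ψ).injective).symm
  rw [this]
  refine (decompositionEquiv p k L ψ).toHomeomorph.isCompact_preimage.mpr ?_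
  rw [← coe_piUnitBallStructure]
  exact (piUnitBallStructure L).isCompact

/-- `(R_I)^∼` as an integral structure, given a decomposition. [cite: Mochizuki2012, IUTchIV Prop. 1.4 (i) p. 13] -/
def normalizedStructure : IntegralStructure (PacketAlgebra p k) :=
  ⟨⟨(normalizedPacket p k).toAddSubgroup, isOpen_normalizedPacket p k⟩,
    isCompact_normalizedPacket_of_decomposition p k L ψ⟩

/-- Unfolding `normalizedStructure`. [cite: Mochizuki2012, IUTchIV Prop. 1.4 (i) p. 13] -/
@[simp] theorem coe_normalizedStructure :
    (normalizedStructure p k L ψ : Set (PacketAlgebra p k)) = normalizedPacket p k := rfl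

omit [Fintype I] [DecidableEq I] [∀ i, IsUltrametricDist (k i)] [∀ i, ProperSpace (k i)] [Nonempty I] in
/-- **`D = dim_{ℚ_p} V`**: the decomposition degree `Σ_j e_j f_j` is `Σ_j [L_j : ℚ_p] = dim V`.
[cite: Mochizuki2012, IUTchIV Prop. 1.4 (i) p. 13] -/
theorem packetDegree_eq_finrank_packetAlgebra : packetDegree p L = finrank ℚ_[p] (PacketAlgebra p k) := by
  haveI : ∀ j, Module.Finite ℚ_[p] (L j) := fun j => finiteDimensional p (L j)
  rw [packetDegree, ψ.toLinearEquiv.finrank_eq, Module.finrank_pi_fintype]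
  exact Finset.sum_congr rfl fun j _ => absRamificationIdx_mul_residueDegree p (L j)

variable [∀ j, MeasurableSpace (L j)] [∀ j, BorelSpace (L j)]

/-- **Bridge**: `packetLogVolume ψ A = tensorLogVolume A` for every `A ⊆ V` of positive finite volume.
[cite: Mochizuki2012, IUTchIV Prop. 1.4 (i) p. 13] -/
theorem packetLogVolume_eq_tensorLogVolume {A : Set (PacketAlgebra p k)}
    (hA : 0 < (integerStructure p k).haar A) (hA' : (integerStructure p k).haar A < ∞) :
    packetLogVolume p k L ψ A = tensorLogVolume p k A := by
  let Λ := integerStructure p k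
  let Λ₂ := normalizedStructure p k L ψ
  have hφ : decompositionEquiv p k L ψ '' (Λ₂ : Set (PacketAlgebra p k)) =
      (piUnitBallStructure L : Set (Π j, L j)) := by
    rw [coe_normalizedStructure, coe_piUnitBallStructure]
    exact image_normalizedPacket p k L ψ
  have h1 : (piUnitBallStructure L).logVolume (ψ '' A) = Λ₂.logVolume A := by
    have := Λ₂.logVolume_image_equiv (piUnitBallStructure L) (decompositionEquiv p k L ψ) hφ A
    exact this
  have h2 : Λ₂.logVolume A = Λ.logVolume A - Λ.logVolume (Λ₂ : Set (PacketAlgebra p k)) :=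
    Λ.logVolume_eq_logVolume_sub Λ₂ hA hA'
  rw [packetLogVolume_def, IntegralStructure.normalizedLogVolume, h1, h2, packetDegree_eq_finrank_packetAlgebra p k L ψ,
    tensorLogVolume, IntegralStructure.normalizedLogVolume, IntegralStructure.normalizedLogVolume,
    coe_normalizedStructure, sub_div]

/-- **`packetLogVolume` does not depend on the decomposition**: two decompositions `ψ`, `ψ'` (possibly
with different factor families) give the same log-volume on sets of positive finite volume.
[cite: Mochizuki2012, IUTchIV Prop. 1.4 (i) p. 13] -/
theorem packetLogVolume_eq_of_decompositions {J' : Type} [Fintype J'] (L' : J' → Type)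
    [∀ j, NontriviallyNormedField (L' j)] [∀ j, NormedAlgebra ℚ_[p] (L' j)] [∀ j, IsUltrametricDist (L' j)]
    [∀ j, ProperSpace (L' j)] [∀ j, MeasurableSpace (L' j)] [∀ j, BorelSpace (L' j)]
    (ψ' : PacketAlgebra p k ≃ₐ[ℚ_[p]] (Π j, L' j)) {A : Set (PacketAlgebra p k)}
    (hA : 0 < (integerStructure p k).haar A) (hA' : (integerStructure p k).haar A < ∞) :
    packetLogVolume p k L ψ A = packetLogVolume p k L' ψ' A := by
  rw [packetLogVolume_eq_tensorLogVolume p k L ψ hA hA', packetLogVolume_eq_tensorLogVolume p k L' ψ' hA hA']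

omit ψ [Fintype J] [∀ j, NontriviallyNormedField (L j)] [∀ j, NormedAlgebra ℚ_[p] (L j)]
  [∀ j, IsUltrametricDist (L j)] [∀ j, ProperSpace (L j)] [∀ j, MeasurableSpace (L j)]
  [∀ j, BorelSpace (L j)] in
/-- **The chosen-decomposition log-measure `packetLogμ` (abc-iut-c312-3's `TensorPacketMeasure.lean`,
along `dEquiv`) is the intrinsic log-volume** on sets of positive finite Haar measure — so every
identity proved ψ-free for `tensorLogVolume` (scaling, the ⊗-lattice identity) transfers to it.
[cite: Mochizuki2012, IUTchIV Prop. 1.4 (i) p. 13] -/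
theorem packetLogμ_eq_tensorLogVolume {A : Set (PacketAlgebra p k)}
    (hA : 0 < (integerStructure p k).haar A) (hA' : (integerStructure p k).haar A < ∞) :
    packetLogμ p k A = tensorLogVolume p k A :=
  packetLogVolume_eq_tensorLogVolume p k (DFac p k) (dEquiv p k) hA hA'

end Literature.IUT.LogVolume

end
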